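import Summits.NavierStokesRegularity.FluidComputer.TwoRowInequality
import Summits.NavierStokesRegularity.FluidComputer.Besov32Clock
import Summits.NavierStokesRegularity.FluidComputer.HomSobolev32Clock
import HarnessLib

/-!
# Fluid computer — L62: THE `Ḃ^{5/2}_{2,2} = Ḣ^{5/2}` ROW AT THE SCALING RATE, WEAK FORM (McCormick et al. 2016, Thm. 3.2):
# `limsup_{t↑T} (T − t)·‖u(t)‖_{Ḣ^{5/2}} ≥ c`, `c` ABSOLUTE

HONEST FRAMING (cell `pub-fluidc`, verbatim): *low prior, high value-of-information experiment on Tao's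
machine paradigm; NOT a claim that NS blows up.* Theorem side of the cell (the level dictionary); nothing here is
evidence of blow-up — necessities for EVERY maximal smooth finite-energy solution on `ℝ³`.

The dictionary's Sobolev table had one hole: the endpoint `s = 5/2` itself. Below it the optimal ladder
`‖u(t)‖_{Ḣ^s} ≳ ν^{(5−2s)/4}(T − t)^{−(2s−1)/4}` (L52/L57/L58, every `s ∈ (1/2, 5/2)`); above it Robinson–Sadowski–Silva's
ν-free rate `2s/5` (L59); straddling it the product clock `‖u‖_{Ḣ^{(5−δ)/2}}‖u‖_{Ḣ^{(5+δ)/2}} ≳ (T − t)^{−2}` (L60); in the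
larger ℓ¹ currency `Ḃ^{5/2}_{2,1}` the strong clock `c/(T − t)` (L61). For `Ḣ^{5/2} = Ḃ^{5/2}_{2,2}` McCormick, Olson,
Robinson, Rodrigo, Vidal-López and Zhou prove only — and exactly — a WEAK estimate at the scaling rate (their Thm. 3.2):
along a sequence of times. With `a_j(τ) = ‖Δ̇_j u(τ)‖₂`, `Y₃ = ∑_j 8^j a_j²` (`≃ ‖u‖²_{Ḣ^{3/2}}`), `Y₅ = ∑_j 32^j a_j²`
(`≃ ‖u‖²_{Ḣ^{5/2}}`), along every maximal smooth solution of the unforced Navier–Stokes system on `ℝ³ × [0, T)`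
(`ν > 0`) which is Leray–Hopf from `u 0`:

* `sub_mul_sq_le_of_two_point` — the comparison lemma: if `Y ≥ 0` is continuous on `[t₁, b]`, `b < T`, and
  `Y(t) − Y(s) ≤ ½ ∫_s^t Y(τ)/(T − τ) dτ` for `t₁ ≤ s ≤ t ≤ b`, then `(T − b)·Y(b)² ≤ (T − t₁)·Y(t₁)²`
  (`Φ = Y(t₁) + ½∫Y/(T−τ)` dominates `Y`, and `(T − t)Φ(t)²` is non-increasing: Grönwall with the weight `T − t`);
* `row5_weak_clock` (**L62, dyadic currency**) — an ABSOLUTE `c > 0` such that for every `ν > 0`, `T > 0`, every such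
  solution and every `t₀ < T` there is `b ∈ (t₀, T) ∩ (0, T)` with `(c/(T − b))² < Y₅(b)`: the `Ḃ^{5/2}_{2,2}` row exceeds
  the scaling-sharp level `(c/(T − t))²` at times arbitrarily close to `T`, i.e. `limsup_{t↑T} (T − t)·Y₅(t)^{1/2} ≥ c`.
  Proof (theirs, in the tree's currency): if `Y₅^{1/2} ≤ c/(T − τ)` on `[t₁, T)` then the ν-FREE two-row law
  `Y₃(t) − Y₃(s) ≤ K∫Y₃ Y₅^{1/2}` (`TwoRowInequality.two_row_two_point`, their (5.4) with the dissipation dropped) gives, for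
  `c = 1/(2K)`, `Y₃(t) − Y₃(s) ≤ ½∫Y₃/(T − τ)`, hence `(T − t)Y₃(t)² ≤ (T − t₁)Y₃(t₁)²` — but the `Ḃ^{3/2}_{2,2}` clock L56
  (`Besov32Clock.besov32_clock`, Cheskidov–Zaya) says `Y₃(t) ≥ ν/(K'(T − t))`, so `(T − t)Y₃(t)² ≥ ν²/(K'²(T − t)) → ∞`;
* `row5_weak_clock_frequently` — the same as `∃ᶠ t in 𝓝[<] T, (c/(T − t))² < Y₅(t)`;
* `homSobolev52_weak_clock` / `homSobolev52_weak_clock_frequently` (**L62 — McCORMICK ET AL.'S THEOREM 3.2 AS PRINTED**):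
  an absolute `c > 0` with `c/(T − t) < ‖u(t)‖_{Ḣ^{5/2}}` at times `t` arbitrarily close to `T` —
  `limsup_{t↑T} (T − t)‖u(t)‖_{Ḣ^{5/2}} ≥ c` (`Ḃ^{5/2}_{2,2} ≤ Ḣ^{5/2}`, `HomSobolev32Clock.tsum_weight_blockL2_sq_le`);
* `homSobolev52_weak_clock_of_cascadeWitness` — the interface reading.

HONEST PLACEMENT: this is McCormick–Olson–Robinson–Rodrigo–Vidal-López–Zhou 2016, Thm. 3.2, typed in the tree's dyadic
currency with the tree's devices (no infinite sum is differentiated; the ODE step is an explicit weighted-monotonicity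
argument); the constant is absolute (no `ν`, no energy) exactly as in print. A STRONG bound `‖u(t)‖_{Ḣ^{5/2}} ≥ c/(T − t)`
at every `t` is NOT claimed (open in print; Cortissoz–Montero–Pinilla 2014 have `c(‖u₀‖₂)/((T − t)|log(T − t)|)`, not
typed here). Necessity only. 0 sorry; no definitions; no named facts.

## References

* D. S. McCormick, E. J. Olson, J. C. Robinson, J. L. Rodrigo, A. Vidal-López, Y. Zhou, *Lower bounds on blowing-up
  solutions of the three-dimensional Navier–Stokes equations in Ḣ^{3/2}, Ḣ^{5/2}, and Ḃ^{5/2}_{2,1}*, SIAM J. Math. Anal.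
  48 (2016) 2119–2132 = arXiv:1503.04323, Thm. 3.2 and its proof (pp. 7–8 of the arXiv version). [MccormickEtAl2016]
* A. Cheskidov, K. Zaya, J. Math. Phys. 57 (2016) 023101 = arXiv:1503.01784, Thm. 2.4. [CheskidovZaya2016]
* J. C. Cortissoz, J. A. Montero, C. E. Pinilla, J. Math. Phys. 55 (2014) 033101 (the log-corrected strong form; context).
  [CortissozMonteroPinilla2014]
* H. Bahouri, J.-Y. Chemin, R. Danchin, Grundlehren 343 (2011), §2.3 (`Ḃ^s_{2,2} = Ḣ^s`). [BahouriCheminDanchin2011]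
-/

noncomputable section

open MeasureTheory Set Function Filter Topology intervalIntegral
open scoped ENNReal NNReal
open Literature.Analysis.FluidPDE Literature.Analysis.FunctionSpaces
open Literature.Analysis.FluidPDE.FluidComputer
open Summit.NavierStokesRegularity.NavierStokesRegularity.Theorems.FluidComputer (x5a_of_cascadeWitness')
open Summit.NavierStokesRegularity.FluidComputer.BlockEnergyTransport
open Summit.NavierStokesRegularity.FluidComputer.TwoRowInequality
open Summit.NavierStokesRegularity.FluidComputer.Besov32Clock
open Summit.NavierStokesRegularity.FluidComputer.HomSobolev32Clock

namespace Summit.NavierStokesRegularity.FluidComputer.Besov52WeakClock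

/-! ## The comparison lemma: Grönwall with the weight `T − t` -/

/-- **Weighted Grönwall comparison.** Let `t₁ < b < T`, `Y ≥ 0` continuous on `[t₁, b]` with
`Y(t) − Y(s) ≤ ½ ∫_s^t Y(τ)/(T − τ) dτ` whenever `t₁ ≤ s ≤ t ≤ b`. Then `(T − b)·Y(b)² ≤ (T − t₁)·Y(t₁)²`.
Proof: `Φ(t) = Y(t₁) + ½∫_{t₁}^t Y/(T − τ)` has `Y ≤ Φ` and `Φ' = ½Y/(T − t) ≤ ½Φ/(T − t)` within `[t₁, b]`
(`intervalIntegral.integral_hasDerivWithinAt_right`), so `((T − t)Φ²)' = Φ(Y − Φ) ≤ 0` and `(T − t)Φ(t)²` is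
non-increasing (`antitoneOn_of_hasDerivWithinAt_nonpos`). [cite: MccormickEtAl2016, proof of Thm. 3.2 (integrating factor)] -/
theorem sub_mul_sq_le_of_two_point {T t₁ b : ℝ} (ht₁b : t₁ < b) (hbT : b < T) {Y : ℝ → ℝ}
    (hYc : ContinuousOn Y (Icc t₁ b)) (hY0 : ∀ τ ∈ Icc t₁ b, 0 ≤ Y τ)
    (hlaw : ∀ s t : ℝ, t₁ ≤ s → s ≤ t → t ≤ b → Y t - Y s ≤ 2⁻¹ * ∫ τ in s..t, Y τ / (T - τ)) :
    (T - b) * Y b ^ 2 ≤ (T - t₁) * Y t₁ ^ 2 := by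
  set φ : ℝ → ℝ := fun τ => Y τ / (T - τ) with hφ
  have hTpos : ∀ τ ∈ Icc t₁ b, 0 < T - τ := fun τ hτ => by linarith [hτ.2]
  have hφc : ContinuousOn φ (Icc t₁ b) :=
    hYc.div (continuousOn_const.sub continuousOn_id) fun τ hτ => (hTpos τ hτ).ne'
  set Φ : ℝ → ℝ := fun t => Y t₁ + 2⁻¹ * ∫ τ in t₁..t, φ τ with hΦ
  -- `Y ≤ Φ` on `[t₁, b]`
  have hYΦ : ∀ t ∈ Icc t₁ b, Y t ≤ Φ t := fun t ht => by
    have h := hlaw t₁ t le_rfl ht.1 ht.2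
    rw [hΦ]; simp only [hφ]
    linarith
  have hΦ0 : ∀ t ∈ Icc t₁ b, 0 ≤ Φ t := fun t ht => (hY0 t ht).trans (hYΦ t ht)
  -- the derivative of `Φ` within `[t₁, b]`
  have hΦ' : ∀ s ∈ Icc t₁ b, HasDerivWithinAt Φ (2⁻¹ * φ s) (Icc t₁ b) s := by
    intro s hs
    haveI : Fact (s ∈ Icc t₁ b) := ⟨hs⟩
    have hint : IntervalIntegrable φ volume t₁ s :=
      (hφc.mono (Icc_subset_Icc_right hs.2)).intervalIntegrable_of_Icc hs.1
    have h : HasDerivWithinAt (fun t => ∫ τ in t₁..t, φ τ) (φ s) (Icc t₁ b) s :=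
      integral_hasDerivWithinAt_right hint
        (hφc.stronglyMeasurableAtFilter_nhdsWithin measurableSet_Icc s) (hφc s hs)
    exact (h.const_mul 2⁻¹).const_add (Y t₁)
  -- `g = (T − t) Φ²` is non-increasing
  set g : ℝ → ℝ := fun t => (T - t) * (Φ t * Φ t) with hg
  set g' : ℝ → ℝ := fun t => -1 * (Φ t * Φ t) + (T - t) * (2⁻¹ * φ t * Φ t + Φ t * (2⁻¹ * φ t)) with hg'
  have hgd : ∀ s ∈ Icc t₁ b, HasDerivWithinAt g (g' s) (Icc t₁ b) s := fun s hs =>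
    ((hasDerivWithinAt_id s (Icc t₁ b)).const_sub T).mul ((hΦ' s hs).mul (hΦ' s hs))
  have hg'le : ∀ s ∈ Icc t₁ b, g' s ≤ 0 := by
    intro s hs
    have hTs := hTpos s hs
    have hφs : (T - s) * φ s = Y s := by
      rw [hφ]; field_simp
    have e : g' s = Φ s * (Y s - Φ s) := by
      rw [hg']; simp only
      rw [← hφs]; ring
    rw [e]
    exact mul_nonpos_of_nonneg_of_nonpos (hΦ0 s hs) (sub_nonpos.2 (hYΦ s hs))
  have hanti : AntitoneOn g (Icc t₁ b) := by
    refine antitoneOn_of_hasDerivWithinAt_nonpos (convex_Icc t₁ b)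
      (fun s hs => (hgd s hs).continuousWithinAt) (f' := g') ?_ ?_
    · intro s hs
      rw [interior_Icc] at hs ⊢
      exact (hgd s (Ioo_subset_Icc_self hs)).mono Ioo_subset_Icc_self
    · intro s hs
      rw [interior_Icc] at hs
      exact hg'le s (Ioo_subset_Icc_self hs)
  have hb : b ∈ Icc t₁ b := right_mem_Icc.2 ht₁b.le
  have hgb : g b ≤ g t₁ := hanti (left_mem_Icc.2 ht₁b.le) hb ht₁b.le
  have hΦt₁ : Φ t₁ = Y t₁ := by rw [hΦ]; simp only [integral_same, mul_zero, add_zero]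
  have hgt₁ : g t₁ = (T - t₁) * Y t₁ ^ 2 := by rw [hg]; simp only [hΦt₁]; ring
  have hgb' : g b = (T - b) * Φ b ^ 2 := by rw [hg]; simp only; ring
  have hYb : Y b ^ 2 ≤ Φ b ^ 2 := pow_le_pow_left₀ (hY0 b hb) (hYΦ b hb) 2
  calc (T - b) * Y b ^ 2 ≤ (T - b) * Φ b ^ 2 := mul_le_mul_of_nonneg_left hYb (hTpos b hb).le
    _ = g b := hgb'.symm
    _ ≤ g t₁ := hgb
    _ = (T - t₁) * Y t₁ ^ 2 := hgt₁

/-! ## L62: the weak `Ḃ^{5/2}_{2,2}` clock -/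

/-- **L62 — THE `Ḃ^{5/2}_{2,2}` ROW AT THE SCALING RATE, WEAK FORM (McCormick–Olson–Robinson–Rodrigo–Vidal-López–Zhou 2016,
Thm. 3.2, dyadic currency).** There is an ABSOLUTE `c > 0` such that for every `ν > 0`, `T > 0`, every maximal smooth
solution `(u, p)` of the unforced Navier–Stokes system on `ℝ³ × [0, T)` which is Leray–Hopf from `u 0`, and every
`t₀ < T`, there is `b ∈ (t₀, T) ∩ (0, T)` with `(c/(T − b))² < ∑_j 32^j ‖Δ̇_j u(b)‖₂²` — i.e.
`limsup_{t↑T} (T − t)·(∑_j 32^j ‖Δ̇_j u(t)‖₂²)^{1/2} ≥ c`, the scaling-sharp rate for `Ḃ^{5/2}_{2,2} = Ḣ^{5/2}` along a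
sequence of times, with NO viscosity and NO energy in the constant. Proof: otherwise `Y₅^{1/2} ≤ c/(T − τ)` on some
`[t₁, T)`; with `c = 1/(2K)`, `K` of the ν-free two-row law `Y₃(t) − Y₃(s) ≤ K∫Y₃Y₅^{1/2}` (`two_row_two_point`), this
gives `Y₃(t) − Y₃(s) ≤ ½∫Y₃/(T − τ)`, so `(T − t)Y₃(t)² ≤ (T − t₁)Y₃(t₁)²` (`sub_mul_sq_le_of_two_point`), contradicting the
`Ḃ^{3/2}_{2,2}` clock `Y₃(t) ≥ ν/(K'(T − t))` (L56, `besov32_clock`) as `t ↑ T`. In cascade words: a design cannot keep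
its `32^j`-weighted energies below `(c/(T − t))²` all the way to the singular time — the `Ḣ^{5/2}`-level must flare up to
the scaling level again and again. Necessity only; a bound at EVERY `t` is not claimed.
[cite: MccormickEtAl2016, Thm. 3.2] [cite: CheskidovZaya2016, Thm. 2.4] -/
theorem row5_weak_clock :
    ∃ c : ℝ, 0 < c ∧ ∀ (ν T : ℝ), 0 < ν → 0 < T →
      ∀ (u : ℝ → EuclideanSpace ℝ (Fin 3) → EuclideanSpace ℝ (Fin 3)) (p : ℝ → EuclideanSpace ℝ (Fin 3) → ℝ),
      IsMaximalSmoothSolution ν 0 u p T → IsLerayHopfOn T ν 0 (u 0) u →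
      ∀ t₀ : ℝ, t₀ < T → ∃ b ∈ Ioo (max t₀ 0) T,
        ENNReal.ofReal ((c / (T - b)) ^ 2) < ∑' j : ℤ, (2 : ℝ≥0∞) ^ ((5 : ℝ) * (j : ℝ)) * blockL2 (u b) j ^ 2 := by
  obtain ⟨K, hK, hlaw⟩ := two_row_two_point
  obtain ⟨K', hK', hclock⟩ := besov32_clock
  refine ⟨1 / (2 * K), by positivity, fun ν T hν hT u p hmax hLH t₀ ht₀ => ?_⟩
  set c : ℝ := 1 / (2 * K) with hc
  have hc0 : 0 < c := by positivity
  set Y : ℝ → ℝ := fun τ => (∑' j : ℤ, (2 : ℝ≥0∞) ^ ((3 : ℝ) * (j : ℝ)) * blockL2 (u τ) j ^ 2).toReal with hY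
  set D : ℝ → ℝ := fun τ => (∑' j : ℤ, (2 : ℝ≥0∞) ^ ((5 : ℝ) * (j : ℝ)) * blockL2 (u τ) j ^ 2).toReal with hD
  have hY0 : ∀ τ, 0 ≤ Y τ := fun τ => ENNReal.toReal_nonneg
  have hD0 : ∀ τ, 0 ≤ D τ := fun τ => ENNReal.toReal_nonneg
  -- an interior anchor `t₁ ∈ (max t₀ 0, T)`
  set t₁ : ℝ := (max t₀ 0 + T) / 2 with ht₁
  have hm : max t₀ 0 < T := max_lt ht₀ hT
  have ht₁I : t₁ ∈ Ioo (max t₀ 0) T := ⟨by rw [ht₁]; linarith, by rw [ht₁]; linarith⟩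
  have ht₁0 : 0 < t₁ := (le_max_right _ _).trans_lt ht₁I.1
  by_contra hcon
  push Not at hcon
  -- under the negation: `D(τ)^{1/2} ≤ c/(T − τ)` on `[t₁, T)`
  have hDle : ∀ τ ∈ Ico t₁ T, D τ ^ (1 / 2 : ℝ) ≤ c / (T - τ) := by
    intro τ hτ
    have hτI : τ ∈ Ioo (max t₀ 0) T := ⟨ht₁I.1.trans_le hτ.1, hτ.2⟩
    have hTτ : 0 < T - τ := sub_pos.2 hτ.2
    have hq : 0 ≤ c / (T - τ) := div_nonneg hc0.le hTτ.le
    have h1 : D τ ≤ (c / (T - τ)) ^ 2 := ENNReal.toReal_le_of_le_ofReal (sq_nonneg _) (hcon τ hτI)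
    rw [← Real.sqrt_eq_rpow]
    calc Real.sqrt (D τ) ≤ Real.sqrt ((c / (T - τ)) ^ 2) := Real.sqrt_le_sqrt h1
      _ = c / (T - τ) := Real.sqrt_sq hq
  -- the two-row law becomes `Y(t) − Y(s) ≤ ½ ∫ Y/(T − τ)` on `[t₁, T)`
  have hlaw' : ∀ s t : ℝ, t₁ ≤ s → s ≤ t → t < T → Y t - Y s ≤ 2⁻¹ * ∫ τ in s..t, Y τ / (T - τ) := by
    intro s t hs hst htT
    have hs0 : 0 < s := ht₁0.trans_le hs
    have h := hlaw ν T hν hT u p hmax hLH s t hs0 hst htT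
    have hYc : ContinuousOn Y (Icc s t) :=
      HighRows.continuousOn_row (κ := 3) (by norm_num) hν hT hmax hLH hs0 hst htT
    have hDc : ContinuousOn D (Icc s t) :=
      HighRows.continuousOn_row (κ := 5) (by norm_num) hν hT hmax hLH hs0 hst htT
    have hTc : ContinuousOn (fun τ => Y τ / (T - τ)) (Icc s t) :=
      hYc.div (continuousOn_const.sub continuousOn_id) fun τ hτ => by
        have : τ < T := hτ.2.trans_lt htT
        exact (sub_pos.2 this).ne'
    have hint1 : IntervalIntegrable (fun τ => Y τ * D τ ^ (1 / 2 : ℝ)) volume s t := by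
      refine ContinuousOn.intervalIntegrable ?_
      rw [uIcc_of_le hst]
      exact hYc.mul (hDc.rpow_const fun τ _ => Or.inr (by norm_num))
    have hint2 : IntervalIntegrable (fun τ => c * (Y τ / (T - τ))) volume s t := by
      refine ContinuousOn.intervalIntegrable ?_
      rw [uIcc_of_le hst]
      exact continuousOn_const.mul hTc
    have hmono : ∫ τ in s..t, Y τ * D τ ^ (1 / 2 : ℝ) ≤ ∫ τ in s..t, c * (Y τ / (T - τ)) := by
      refine intervalIntegral.integral_mono_on hst hint1 hint2 fun τ hτ => ?_
      have hτ' : τ ∈ Ico t₁ T := ⟨hs.trans hτ.1, hτ.2.trans_lt htT⟩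
      have hTτ : 0 < T - τ := sub_pos.2 hτ'.2
      calc Y τ * D τ ^ (1 / 2 : ℝ) ≤ Y τ * (c / (T - τ)) := mul_le_mul_of_nonneg_left (hDle τ hτ') (hY0 τ)
        _ = c * (Y τ / (T - τ)) := by field_simp
    rw [intervalIntegral.integral_const_mul] at hmono
    have hKc : K * c = 2⁻¹ := by rw [hc]; field_simp
    calc Y t - Y s ≤ K * ∫ τ in s..t, Y τ * D τ ^ (1 / 2 : ℝ) := h
      _ ≤ K * (c * ∫ τ in s..t, Y τ / (T - τ)) := mul_le_mul_of_nonneg_left hmono hK.le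
      _ = 2⁻¹ * ∫ τ in s..t, Y τ / (T - τ) := by rw [← mul_assoc, hKc]
  -- choose `b` close to `T`
  have hTt₁ : 0 < T - t₁ := sub_pos.2 ht₁I.2
  have hK'0 : K' ≠ 0 := hK'.ne'
  set A : ℝ := (T - t₁) * Y t₁ ^ 2 + 1 with hA
  have hA0 : 0 < A := by rw [hA]; nlinarith [mul_nonneg hTt₁.le (sq_nonneg (Y t₁))]
  have hA' : A ≠ 0 := hA0.ne'
  have h2KA : 0 < 2 * K' ^ 2 * A := mul_pos (mul_pos two_pos (pow_pos hK' 2)) hA0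
  set δ : ℝ := min ((T - t₁) / 2) (ν ^ 2 / (2 * K' ^ 2 * A)) with hδ
  have hδ0 : 0 < δ := lt_min (by linarith [ht₁I.2]) (div_pos (pow_pos hν 2) h2KA)
  have hδ1 : δ ≤ (T - t₁) / 2 := min_le_left _ _
  have hδ2 : δ ≤ ν ^ 2 / (2 * K' ^ 2 * A) := min_le_right _ _
  set b : ℝ := T - δ with hb
  have ht₁b : t₁ < b := by rw [hb]; linarith [ht₁I.2]
  have hbT : b < T := by rw [hb]; linarith
  have hb0 : 0 < b := ht₁0.trans ht₁b
  have hTb : T - b = δ := by rw [hb]; ring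
  -- the weighted Grönwall comparison on `[t₁, b]`
  have hYc : ContinuousOn Y (Icc t₁ b) :=
    HighRows.continuousOn_row (κ := 3) (by norm_num) hν hT hmax hLH ht₁0 ht₁b.le hbT
  have hcmp : (T - b) * Y b ^ 2 ≤ (T - t₁) * Y t₁ ^ 2 :=
    sub_mul_sq_le_of_two_point ht₁b hbT hYc (fun τ _ => hY0 τ)
      fun s t hs hst htb => hlaw' s t hs hst (htb.trans_lt hbT)
  -- the `Ḃ^{3/2}_{2,2}` clock at `b`
  have hrow : ν / (K' * (T - b)) ≤ Y b := by
    have h := hclock ν T hν hT u p hmax hLH b ⟨hb0, hbT⟩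
    have htop := RiccatiInequality.besov32_ne_top hν hT hmax hLH ⟨hb0, hbT⟩
    exact (ENNReal.ofReal_le_iff_le_toReal htop).1 h
  have hTb0 : 0 < T - b := sub_pos.2 hbT
  have hTb' : T - b ≠ 0 := hTb0.ne'
  have hq0 : 0 ≤ ν / (K' * (T - b)) := div_nonneg hν.le (mul_pos hK' hTb0).le
  have hsq : (ν / (K' * (T - b))) ^ 2 ≤ Y b ^ 2 := pow_le_pow_left₀ hq0 hrow 2
  have hlow : ν ^ 2 / (K' ^ 2 * (T - b)) ≤ (T - b) * Y b ^ 2 := by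
    have e : ν ^ 2 / (K' ^ 2 * (T - b)) = (T - b) * (ν / (K' * (T - b))) ^ 2 := by
      field_simp
    rw [e]
    exact mul_le_mul_of_nonneg_left hsq hTb0.le
  -- but `T − b = δ ≤ ν²/(2K'²A)` makes the left side `≥ 2A > (T − t₁)Y(t₁)²`
  have hbig : 2 * A ≤ ν ^ 2 / (K' ^ 2 * (T - b)) := by
    rw [hTb, le_div_iff₀ (mul_pos (pow_pos hK' 2) hδ0)]
    calc 2 * A * (K' ^ 2 * δ) = (2 * K' ^ 2 * A) * δ := by ring
      _ ≤ (2 * K' ^ 2 * A) * (ν ^ 2 / (2 * K' ^ 2 * A)) := mul_le_mul_of_nonneg_left hδ2 h2KA.le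
      _ = ν ^ 2 := by field_simp
  have hAlt : (T - t₁) * Y t₁ ^ 2 < 2 * A := by rw [hA]; nlinarith [sq_nonneg (Y t₁), ht₁I.2]
  linarith

/-- **L62, filter form**: with the constant `c` of `row5_weak_clock`, along every maximal smooth Leray–Hopf solution
of the unforced system (`ν > 0`): `∃ᶠ t in 𝓝[<] T, (c/(T − t))² < ∑_j 32^j ‖Δ̇_j u(t)‖₂²` — frequently as `t ↑ T`
the `Ḃ^{5/2}_{2,2}` row is above the scaling level. [cite: MccormickEtAl2016, Thm. 3.2] -/
theorem row5_weak_clock_frequently {ν T : ℝ} (hν : 0 < ν) (hT : 0 < T)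
    {u : ℝ → EuclideanSpace ℝ (Fin 3) → EuclideanSpace ℝ (Fin 3)} {p : ℝ → EuclideanSpace ℝ (Fin 3) → ℝ}
    (hmax : IsMaximalSmoothSolution ν 0 u p T) (hLH : IsLerayHopfOn T ν 0 (u 0) u) :
    ∃ᶠ t in 𝓝[<] T, ENNReal.ofReal ((row5_weak_clock.choose / (T - t)) ^ 2) <
      ∑' j : ℤ, (2 : ℝ≥0∞) ^ ((5 : ℝ) * (j : ℝ)) * blockL2 (u t) j ^ 2 := by
  have H := row5_weak_clock.choose_spec.2 ν T hν hT u p hmax hLH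
  rw [Filter.frequently_iff]
  intro U hU
  obtain ⟨l, hl, hlU⟩ := mem_nhdsLT_iff_exists_Ioo_subset.1 hU
  obtain ⟨b, hb, hbY⟩ := H l hl
  exact ⟨b, hlU ⟨(le_max_left _ _).trans_lt hb.1, hb.2⟩, hbY⟩

/-! ## L62 in the `Ḣ^{5/2}` currency -/

/-- `∑_j 32^j ‖Δ̇_j v‖₂² ≤ 256 ‖v‖²_{Ḣ^{5/2}}` for a finite-energy field (`tsum_weight_blockL2_sq_le` at `s = 5/2`).
[cite: BahouriCheminDanchin2011, §2.3 (Ḃ^s_{2,2} = Ḣ^s)] -/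
theorem row5_le_homSobolev_sq {v : EuclideanSpace ℝ (Fin 3) → EuclideanSpace ℝ (Fin 3)} (hv : MemLp v 2 volume) :
    ∑' j : ℤ, (2 : ℝ≥0∞) ^ ((5 : ℝ) * (j : ℝ)) * blockL2 v j ^ 2 ≤
      256 * Function.eHomSobolevSeminorm (5 / 2 : ℝ) (⇑EuclideanSpace.complexify ∘ v) ^ 2 := by
  have h := tsum_weight_blockL2_sq_le (5 / 2 : ℝ) hv
  have e1 : ∀ j : ℤ, (2 : ℝ≥0∞) ^ (2 * (5 / 2 : ℝ) * (j : ℝ)) = (2 : ℝ≥0∞) ^ ((5 : ℝ) * (j : ℝ)) := fun j => by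
    norm_num
  simp_rw [e1] at h
  have e2 : (8 : ℝ≥0∞) * (2 : ℝ≥0∞) ^ |2 * (5 / 2 : ℝ)| = 256 := by
    rw [show |2 * (5 / 2 : ℝ)| = ((5 : ℕ) : ℝ) by norm_num, ENNReal.rpow_natCast]
    norm_num
  rwa [e2] at h

/-- **L62 — McCORMICK–OLSON–ROBINSON–RODRIGO–VIDAL-LÓPEZ–ZHOU'S THEOREM 3.2, AS PRINTED: there is an ABSOLUTE `c > 0`
such that for every `ν > 0`, `T > 0`, every maximal smooth solution `(u, p)` of the unforced Navier–Stokes system on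
`ℝ³ × [0, T)` which is Leray–Hopf from `u 0`, and every `t₀ < T`, some `b ∈ (t₀, T) ∩ (0, T)` has
`c/(T − b) < ‖u(b)‖_{Ḣ^{5/2}}`** — `limsup_{t↑T} (T − t)‖u(t)‖_{Ḣ^{5/2}} ≥ c`: the scaling-sharp rate for `Ḣ^{5/2}`
itself, along a sequence of times, no viscosity and no energy in the constant (`row5_weak_clock` read through
`∑_j 32^j a_j² ≤ 256‖u‖²_{Ḣ^{5/2}}`). This closes the dictionary's Sobolev table at the endpoint `s = 5/2` in the only
form print has: L52/L57/L58 below `5/2` (optimal, with `ν`), L59 above (rate `2s/5`, `ν`-free), L60 straddling, L61 in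
`Ḃ^{5/2}_{2,1}` (strong, `ν`-free), L62 at `5/2` (weak, `ν`-free). A strong bound at every `t` is NOT claimed.
Necessity only. [cite: MccormickEtAl2016, Thm. 3.2] [cite: CheskidovZaya2016, Thm. 2.4] -/
theorem homSobolev52_weak_clock :
    ∃ c : ℝ, 0 < c ∧ ∀ (ν T : ℝ), 0 < ν → 0 < T →
      ∀ (u : ℝ → EuclideanSpace ℝ (Fin 3) → EuclideanSpace ℝ (Fin 3)) (p : ℝ → EuclideanSpace ℝ (Fin 3) → ℝ),
      IsMaximalSmoothSolution ν 0 u p T → IsLerayHopfOn T ν 0 (u 0) u →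
      ∀ t₀ : ℝ, t₀ < T → ∃ b ∈ Ioo (max t₀ 0) T,
        ENNReal.ofReal (c / (T - b)) < Function.eHomSobolevSeminorm (5 / 2 : ℝ) (⇑EuclideanSpace.complexify ∘ u b) := by
  obtain ⟨c, hc, H⟩ := row5_weak_clock
  refine ⟨c / 16, by positivity, fun ν T hν hT u p hmax hLH t₀ ht₀ => ?_⟩
  obtain ⟨b, hb, hbY⟩ := H ν T hν hT u p hmax hLH t₀ ht₀
  refine ⟨b, hb, ?_⟩
  have hb0 : 0 < b := (le_max_right _ _).trans_lt hb.1
  have hTb : 0 < T - b := sub_pos.2 hb.2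
  have hub : MemLp (u b) 2 volume := hLH.memLp b ⟨hb0.le, hb.2.le⟩
  set S : ℝ≥0∞ := Function.eHomSobolevSeminorm (5 / 2 : ℝ) (⇑EuclideanSpace.complexify ∘ u b) with hS
  have h1 : ENNReal.ofReal ((c / (T - b)) ^ 2) < 256 * S ^ 2 := hbY.trans_le (row5_le_homSobolev_sq hub)
  have h2 : ENNReal.ofReal (c / (T - b)) ^ 2 < (16 * S) ^ 2 := by
    rw [← ENNReal.ofReal_pow (div_nonneg hc.le hTb.le)]
    calc ENNReal.ofReal ((c / (T - b)) ^ 2) < 256 * S ^ 2 := h1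
      _ = (16 * S) ^ 2 := by ring
  have h3 : ENNReal.ofReal (c / (T - b)) < 16 * S := (ENNReal.pow_lt_pow_left_iff two_ne_zero).1 h2
  have e : ENNReal.ofReal (c / 16 / (T - b)) = ENNReal.ofReal (c / (T - b)) / 16 := by
    rw [show c / 16 / (T - b) = c / (T - b) / 16 by ring, ENNReal.ofReal_div_of_pos (by norm_num)]
    norm_num
  rw [e, ENNReal.div_lt_iff (Or.inl (by norm_num)) (Or.inl (by norm_num))]
  rwa [mul_comm] at h3

/-- **L62, filter form in `Ḣ^{5/2}`**: with the constant `c` of `homSobolev52_weak_clock`, along every maximal smooth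
Leray–Hopf solution of the unforced system (`ν > 0`): `∃ᶠ t in 𝓝[<] T, c/(T − t) < ‖u(t)‖_{Ḣ^{5/2}}`, i.e.
`limsup_{t↑T} (T − t)‖u(t)‖_{Ḣ^{5/2}} ≥ c`. [cite: MccormickEtAl2016, Thm. 3.2] -/
theorem homSobolev52_weak_clock_frequently {ν T : ℝ} (hν : 0 < ν) (hT : 0 < T)
    {u : ℝ → EuclideanSpace ℝ (Fin 3) → EuclideanSpace ℝ (Fin 3)} {p : ℝ → EuclideanSpace ℝ (Fin 3) → ℝ}
    (hmax : IsMaximalSmoothSolution ν 0 u p T) (hLH : IsLerayHopfOn T ν 0 (u 0) u) :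
    ∃ᶠ t in 𝓝[<] T, ENNReal.ofReal (homSobolev52_weak_clock.choose / (T - t)) <
      Function.eHomSobolevSeminorm (5 / 2 : ℝ) (⇑EuclideanSpace.complexify ∘ u t) := by
  have H := homSobolev52_weak_clock.choose_spec.2 ν T hν hT u p hmax hLH
  rw [Filter.frequently_iff]
  intro U hU
  obtain ⟨l, hl, hlU⟩ := mem_nhdsLT_iff_exists_Ioo_subset.1 hU
  obtain ⟨b, hb, hbY⟩ := H l hl
  exact ⟨b, hlU ⟨(le_max_left _ _).trans_lt hb.1, hb.2⟩, hbY⟩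

/-! ## The interface reading -/

/-- **L62 READ ON THE INTERFACE: every cascade witness has `limsup_{t↑T} (T − t)‖u(t)‖_{Ḣ^{5/2}} ≥ c`, `c` absolute.**
Every `W : CascadeWitness` yields `ν > 0`, `T > 0` and a maximal smooth solution `(u, p)` of the unforced Navier–Stokes
system on `ℝ³ × [0, T)`, Leray–Hopf from `u 0` (`x5a_of_cascadeWitness'`), such that with the constant `c` of
`homSobolev52_weak_clock`: for every `t₀ < T` some `b ∈ (t₀, T) ∩ (0, T)` has `c/(T − b) < ‖u(b)‖_{Ḣ^{5/2}}`.
[cite: MccormickEtAl2016, Thm. 3.2] -/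
theorem homSobolev52_weak_clock_of_cascadeWitness (W : CascadeWitness) :
    ∃ ν : ℝ, 0 < ν ∧ ∃ T : ℝ, 0 < T ∧
      ∃ (u : ℝ → EuclideanSpace ℝ (Fin 3) → EuclideanSpace ℝ (Fin 3)) (p : ℝ → EuclideanSpace ℝ (Fin 3) → ℝ),
        IsMaximalSmoothSolution ν 0 u p T ∧ IsLerayHopfOn T ν 0 (u 0) u ∧
        ∀ t₀ : ℝ, t₀ < T → ∃ b ∈ Ioo (max t₀ 0) T,
          ENNReal.ofReal (homSobolev52_weak_clock.choose / (T - b)) <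
            Function.eHomSobolevSeminorm (5 / 2 : ℝ) (⇑EuclideanSpace.complexify ∘ u b) := by
  obtain ⟨ν, hν, T, hT, u, p, hmax, hLH, -⟩ := x5a_of_cascadeWitness' W
  exact ⟨ν, hν, T, hT, u, p, hmax, hLH, homSobolev52_weak_clock.choose_spec.2 ν T hν hT u p hmax hLH⟩

end Summit.NavierStokesRegularity.FluidComputer.Besov52WeakClock

end
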